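import Summits.CriticalPhenomena.PercolationContinuityZ3.Theorems.PercNearOneGluingNoHeavyLowerTailSahiCombDisjunctThreeComb

/-!
# The comb (tensor-Bernstein) hierarchy for Sahi's `E_k`, XXI: CONJUNCTIVE CLOSURE AT ORDER 3 — AND-ing a fresh coordinate into any sub-collection
# of a comb-positive triple keeps it comb-positive; conjunctive padding by an independent AND-system (cylinders)

Support file of the one-cut programme (crux `NoHeavyLowerTail`, stmt-CriticalPhenomena-4575; cell `prim-masterthm`, seat P3, gen 4;
`run/shared/lean/prim/prim-masterthm/prim-masterthm-p3/HIERARCHY.md` §11).  Companion of `…SahiCombDisjunctThreeIdentities/Comb` (the OR case); same method.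

For increasing `U_0,U_1,U_2` ignoring the coordinate `e`, `t = p_e`, and `V_j = U_j ∩ {e ∈ ω}` (`j ∈ G`), `V_j = U_j` otherwise, the one-coordinate Bernstein
pieces of `E_3(1_V)` are again explicit and manifestly nonnegative (`m_R = μ(⋂_R U_j)`, `X = Σ_k Cov(1_{U_i∩U_j},1_{U_k})`):
* `|G| = 1`: `E_3(V) = t·E_3(U)`;
* `|G| = 2`: `E_3(V) = t²·E_3(U) + t(1−t)·[Cov(1_{U_0∩U_1},1_{U_2}) + m_{012}]`;
* `|G| = 3`: `E_3(V) = t³·E_3(U) + t²(1−t)·[X + m_{012}] + 2t(1−t)²·m_{012}`.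
(This is the order-3 case of the tensorisation stratum R8 of `…SahiCombTensorisation`, written out so that only `E_3(1_U)`, (M⁺-2) covariances and moments appear.)
* **`combPos_sahiE_three_interCoord_one/two/three`**, **`combPos_sahiE_three_interCoord`** (any decidable sub-collection);
* **`combPos_sahiE_three_inter_and`** — CONJUNCTIVE PADDING: for every comb-positive triple `U` of increasing events and coordinate sets `S_k` ignored by the `U_j`,
  `(U_k ∩ {ω | S_k ⊆ ω})_k` is comb-positive at multidegree `3`.
Together with the disjunctive closure: (M⁺-3) is stable under OR-ing or AND-ing fresh coordinates into arbitrary sub-collections, in any order ("caterpillar" triples over a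
comb-positive core); the all-order analogue is the MIXTURE CONJECTURE of HIERARCHY §11 (not asserted).
HONEST FRAMING: nothing here asserts (M⁺-k) or `C_k` for `k ≥ 3` in general. [this work]
-/

noncomputable section

open scoped Classical

namespace Summit.CriticalPhenomena.PercolationContinuityZ3.Theorems

open Finset Function
open Literature.Combinatorics.Sahi2008
open Literature.Probability.Percolation.BHK2006 (ind_inter)
open Literature.Probability.Percolation.DecisionTree (ind ind_of_mem ind_of_not_mem ind_nonneg)
open SahiComb SahiCombDisjunct

variable {ι : Type} [Fintype ι]

namespace SahiCombConjunct

/-! ### The three identities -/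

section Identities

variable (U : Fin 3 → Set (Set ι)) (e : ι) (hUe : ∀ (j : Fin 3) (b : Bool), secAt e b (U j) = U j) (p : ι → unitInterval)
include hUe

attribute [local simp] secAt_inter secAt_union secAt_true_coord secAt_false_coord

/-- **`|G| = 1`**: `E_3(1_{U_0 ∩ {e∈ω}}, 1_{U_1}, 1_{U_2}) = p_e·E_3(1_U)`. [this work] -/
theorem sahiE_three_interCoord_one :
    sahiE (bernoulliWeight p) 3 ![ind (U 0 ∩ {ω : Set ι | e ∈ ω}), ind (U 1), ind (U 2)] =
      (p e : ℝ) * sahiE (bernoulliWeight p) 3 ![ind (U 0), ind (U 1), ind (U 2)] := by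
  have h0 : ex (bernoulliWeight p) (ind (U 0 ∩ {ω : Set ι | e ∈ ω})) =
      (p e : ℝ) * ex (bernoulliWeight p) (ind (U 0)) + (1 - (p e : ℝ)) * ex (bernoulliWeight p) (ind (∅ : Set (Set ι))) :=
    ex_ind_of_secAt p e (by simp [hUe]) (by simp [hUe])
  have h01 : ex (bernoulliWeight p) (ind (U 0 ∩ {ω : Set ι | e ∈ ω} ∩ U 1)) =
      (p e : ℝ) * ex (bernoulliWeight p) (ind (U 0 ∩ U 1)) + (1 - (p e : ℝ)) * ex (bernoulliWeight p) (ind (∅ : Set (Set ι))) :=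
    ex_ind_of_secAt p e (by simp [hUe]) (by simp [hUe])
  have h02 : ex (bernoulliWeight p) (ind (U 0 ∩ {ω : Set ι | e ∈ ω} ∩ U 2)) =
      (p e : ℝ) * ex (bernoulliWeight p) (ind (U 0 ∩ U 2)) + (1 - (p e : ℝ)) * ex (bernoulliWeight p) (ind (∅ : Set (Set ι))) :=
    ex_ind_of_secAt p e (by simp [hUe]) (by simp [hUe])
  have h012 : ex (bernoulliWeight p) (ind (U 0 ∩ {ω : Set ι | e ∈ ω} ∩ U 1 ∩ U 2)) =
      (p e : ℝ) * ex (bernoulliWeight p) (ind (U 0 ∩ U 1 ∩ U 2)) + (1 - (p e : ℝ)) * ex (bernoulliWeight p) (ind (∅ : Set (Set ι))) :=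
    ex_ind_of_secAt p e (by simp [hUe]) (by simp [hUe])
  rw [sahiE_three, sahiE_three]
  simp only [ind_mul_ind_eq_inter]
  rw [h0, h01, h02, h012, ex_ind_empty]
  ring

/-- **`|G| = 2`**: `E_3(1_{U_0∩{e}}, 1_{U_1∩{e}}, 1_{U_2}) = p_e²·E_3(1_U) + p_e(1−p_e)·[Cov(1_{U_0∩U_1},1_{U_2}) + μ(U_0∩U_1∩U_2)]`. [this work] -/
theorem sahiE_three_interCoord_two :
    sahiE (bernoulliWeight p) 3 ![ind (U 0 ∩ {ω : Set ι | e ∈ ω}), ind (U 1 ∩ {ω : Set ι | e ∈ ω}), ind (U 2)] =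
      (p e : ℝ) ^ 2 * sahiE (bernoulliWeight p) 3 ![ind (U 0), ind (U 1), ind (U 2)] +
        (p e : ℝ) * (1 - (p e : ℝ)) * (covFun (U 0 ∩ U 1) (U 2) p + ex (bernoulliWeight p) (ind (U 0 ∩ U 1 ∩ U 2))) := by
  have h0 : ex (bernoulliWeight p) (ind (U 0 ∩ {ω : Set ι | e ∈ ω})) =
      (p e : ℝ) * ex (bernoulliWeight p) (ind (U 0)) + (1 - (p e : ℝ)) * ex (bernoulliWeight p) (ind (∅ : Set (Set ι))) :=
    ex_ind_of_secAt p e (by simp [hUe]) (by simp [hUe])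
  have h1 : ex (bernoulliWeight p) (ind (U 1 ∩ {ω : Set ι | e ∈ ω})) =
      (p e : ℝ) * ex (bernoulliWeight p) (ind (U 1)) + (1 - (p e : ℝ)) * ex (bernoulliWeight p) (ind (∅ : Set (Set ι))) :=
    ex_ind_of_secAt p e (by simp [hUe]) (by simp [hUe])
  have h01 : ex (bernoulliWeight p) (ind (U 0 ∩ {ω : Set ι | e ∈ ω} ∩ (U 1 ∩ {ω : Set ι | e ∈ ω}))) =
      (p e : ℝ) * ex (bernoulliWeight p) (ind (U 0 ∩ U 1)) + (1 - (p e : ℝ)) * ex (bernoulliWeight p) (ind (∅ : Set (Set ι))) :=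
    ex_ind_of_secAt p e (by simp [hUe]) (by simp [hUe])
  have h02 : ex (bernoulliWeight p) (ind (U 0 ∩ {ω : Set ι | e ∈ ω} ∩ U 2)) =
      (p e : ℝ) * ex (bernoulliWeight p) (ind (U 0 ∩ U 2)) + (1 - (p e : ℝ)) * ex (bernoulliWeight p) (ind (∅ : Set (Set ι))) :=
    ex_ind_of_secAt p e (by simp [hUe]) (by simp [hUe])
  have h12 : ex (bernoulliWeight p) (ind (U 1 ∩ {ω : Set ι | e ∈ ω} ∩ U 2)) =
      (p e : ℝ) * ex (bernoulliWeight p) (ind (U 1 ∩ U 2)) + (1 - (p e : ℝ)) * ex (bernoulliWeight p) (ind (∅ : Set (Set ι))) :=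
    ex_ind_of_secAt p e (by simp [hUe]) (by simp [hUe])
  have h012 : ex (bernoulliWeight p) (ind (U 0 ∩ {ω : Set ι | e ∈ ω} ∩ (U 1 ∩ {ω : Set ι | e ∈ ω}) ∩ U 2)) =
      (p e : ℝ) * ex (bernoulliWeight p) (ind (U 0 ∩ U 1 ∩ U 2)) + (1 - (p e : ℝ)) * ex (bernoulliWeight p) (ind (∅ : Set (Set ι))) :=
    ex_ind_of_secAt p e (by simp [hUe]) (by simp [hUe])
  rw [sahiE_three, sahiE_three, covFun]
  simp only [ind_mul_ind_eq_inter]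
  rw [h0, h1, h01, h02, h12, h012, ex_ind_empty]
  ring

/-- **`|G| = 3`**: `E_3(1_{U∩{e}}) = t³E_3(1_U) + t²(1−t)·[Σ_k Cov(1_{U_i∩U_j},1_{U_k}) + μ(⋂U)] + 2t(1−t)²·μ(⋂U)` (`t = p_e`). [this work] -/
theorem sahiE_three_interCoord_three :
    sahiE (bernoulliWeight p) 3
        ![ind (U 0 ∩ {ω : Set ι | e ∈ ω}), ind (U 1 ∩ {ω : Set ι | e ∈ ω}), ind (U 2 ∩ {ω : Set ι | e ∈ ω})] =
      (p e : ℝ) ^ 3 * sahiE (bernoulliWeight p) 3 ![ind (U 0), ind (U 1), ind (U 2)] +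
        ((p e : ℝ) ^ 2 * (1 - (p e : ℝ))) *
          ((covFun (U 1 ∩ U 2) (U 0) p + covFun (U 0 ∩ U 2) (U 1) p + covFun (U 0 ∩ U 1) (U 2) p)
            + ex (bernoulliWeight p) (ind (U 0 ∩ U 1 ∩ U 2))) +
        2 * ((p e : ℝ) * (1 - (p e : ℝ)) ^ 2) * ex (bernoulliWeight p) (ind (U 0 ∩ U 1 ∩ U 2)) := by
  have hsing : ∀ j : Fin 3, ex (bernoulliWeight p) (ind (U j ∩ {ω : Set ι | e ∈ ω})) =
      (p e : ℝ) * ex (bernoulliWeight p) (ind (U j)) + (1 - (p e : ℝ)) * ex (bernoulliWeight p) (ind (∅ : Set (Set ι))) := fun j =>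
    ex_ind_of_secAt p e (by simp [hUe]) (by simp [hUe])
  have hpair : ∀ i j : Fin 3, ex (bernoulliWeight p) (ind (U i ∩ {ω : Set ι | e ∈ ω} ∩ (U j ∩ {ω : Set ι | e ∈ ω}))) =
      (p e : ℝ) * ex (bernoulliWeight p) (ind (U i ∩ U j)) + (1 - (p e : ℝ)) * ex (bernoulliWeight p) (ind (∅ : Set (Set ι))) := fun i j =>
    ex_ind_of_secAt p e (by simp [hUe]) (by simp [hUe])
  have h012 : ex (bernoulliWeight p)
      (ind (U 0 ∩ {ω : Set ι | e ∈ ω} ∩ (U 1 ∩ {ω : Set ι | e ∈ ω}) ∩ (U 2 ∩ {ω : Set ι | e ∈ ω}))) =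
      (p e : ℝ) * ex (bernoulliWeight p) (ind (U 0 ∩ U 1 ∩ U 2)) + (1 - (p e : ℝ)) * ex (bernoulliWeight p) (ind (∅ : Set (Set ι))) :=
    ex_ind_of_secAt p e (by simp [hUe]) (by simp [hUe])
  have i120 : U 1 ∩ U 2 ∩ U 0 = U 0 ∩ U 1 ∩ U 2 := by ext ω; simp only [Set.mem_inter_iff]; tauto
  have i021 : U 0 ∩ U 2 ∩ U 1 = U 0 ∩ U 1 ∩ U 2 := by ext ω; simp only [Set.mem_inter_iff]; tauto
  rw [covFun, covFun, covFun, i120, i021, sahiE_three, sahiE_three]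
  simp only [ind_mul_ind_eq_inter]
  rw [hsing 0, hsing 1, hsing 2, hpair 0 1, hpair 0 2, hpair 1 2, h012, ex_ind_empty]
  ring

end Identities

/-! ### Comb positivity -/

section Comb

variable (U : Fin 3 → Set (Set ι)) (hU : ∀ j, IsUpperSet (U j)) (e : ι)
  (hUe : ∀ (j : Fin 3) (b : Bool), secAt e b (U j) = U j)
  (h3 : CombPos (fun _ : ι => 3) (fun p => sahiE (bernoulliWeight p) 3 (fun j => ind (U j))))
include hU hUe h3

omit hU h3 in
/-- The moment `μ(U_0∩U_1∩U_2)` as a comb certificate of multidegree `1` off `e`. [this work] -/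
theorem combPos_m012_off : CombPos (update (fun _ : ι => 1) e 0) (fun p => ex (bernoulliWeight p) (ind (U 0 ∩ U 1 ∩ U 2))) :=
  (combPos_ex_ind (U 0 ∩ U 1 ∩ U 2)).of_ignores e (fun p s => ex_ind_UUU_update U e hUe p s)

omit hU in
/-- **`|G| = 1`: AND-ing a fresh coordinate into ONE member keeps (M⁺-3).** [this work] -/
theorem combPos_sahiE_three_interCoord_one :
    CombPos (fun _ : ι => 3) (fun p => sahiE (bernoulliWeight p) 3 ![ind (U 0 ∩ {ω : Set ι | e ∈ ω}), ind (U 1), ind (U 2)]) := by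
  have hA := combPos_sahiE_three_U_off U e hUe h3
  refine ((combPos_coord_pow e 1 0).mul_of_le hA (deg_le_three e (by norm_num) le_rfl)).congr fun p => ?_
  rw [sahiE_three_interCoord_one U e hUe p]; ring

/-- **`|G| = 2`: AND-ing a fresh coordinate into TWO members keeps (M⁺-3).** [this work] -/
theorem combPos_sahiE_three_interCoord_two :
    CombPos (fun _ : ι => 3) (fun p => sahiE (bernoulliWeight p) 3
      ![ind (U 0 ∩ {ω : Set ι | e ∈ ω}), ind (U 1 ∩ {ω : Set ι | e ∈ ω}), ind (U 2)]) := by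
  have hA := combPos_sahiE_three_U_off U e hUe h3
  have hB : CombPos (update (fun _ : ι => 2) e 0) (covFun (U 0 ∩ U 1) (U 2)) :=
    (combPos_covFun (U 0 ∩ U 1) (U 2) ((hU 0).inter (hU 1)) (hU 2)).of_ignores e (fun p s => covFun_UU_update U e hUe 0 1 2 p s)
  have hC := (combPos_m012_off U e hUe).mono (show update (fun _ : ι => 1) e 0 ≤ update (fun _ : ι => 2) e 0 from fun x => by
    by_cases hx : x = e
    · subst hx; simp
    · simp [hx])
  have h1 := (combPos_coord_pow e 2 0).mul_of_le hA (deg_le_three e (by norm_num) le_rfl)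
  have h2 := (combPos_coord_pow e 1 1).mul_of_le (hB.add hC) (deg_le_three e (by norm_num) (by norm_num))
  refine (h1.add h2).congr fun p => ?_
  rw [sahiE_three_interCoord_two U e hUe p]; ring

/-- **`|G| = 3`: AND-ing a fresh coordinate into ALL THREE members keeps (M⁺-3).** [this work] -/
theorem combPos_sahiE_three_interCoord_three :
    CombPos (fun _ : ι => 3) (fun p => sahiE (bernoulliWeight p) 3
      ![ind (U 0 ∩ {ω : Set ι | e ∈ ω}), ind (U 1 ∩ {ω : Set ι | e ∈ ω}), ind (U 2 ∩ {ω : Set ι | e ∈ ω})]) := by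
  have hA := combPos_sahiE_three_U_off U e hUe h3
  have hX : CombPos (update (fun _ : ι => 2) e 0)
      (fun p => covFun (U 1 ∩ U 2) (U 0) p + covFun (U 0 ∩ U 2) (U 1) p + covFun (U 0 ∩ U 1) (U 2) p) :=
    ((((combPos_covFun _ _ ((hU 1).inter (hU 2)) (hU 0)).of_ignores e (fun p s => covFun_UU_update U e hUe 1 2 0 p s)).add
      ((combPos_covFun _ _ ((hU 0).inter (hU 2)) (hU 1)).of_ignores e (fun p s => covFun_UU_update U e hUe 0 2 1 p s))).add
      ((combPos_covFun _ _ ((hU 0).inter (hU 1)) (hU 2)).of_ignores e (fun p s => covFun_UU_update U e hUe 0 1 2 p s)))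
  have hM := combPos_m012_off U e hUe
  have d12 : update (fun _ : ι => 1) e 0 ≤ update (fun _ : ι => 2) e 0 := fun x => by
    by_cases hx : x = e
    · subst hx; simp
    · simp [hx]
  have h1 := (combPos_coord_pow e 3 0).mul_of_le hA (deg_le_three e (by norm_num) le_rfl)
  have h2 := (combPos_coord_pow e 2 1).mul_of_le (hX.add (hM.mono d12)) (deg_le_three e (by norm_num) (by norm_num))
  have h3' := ((combPos_coord_pow e 1 2).mul_of_le hM (deg_le_three e (by norm_num) (by norm_num))).smul (by norm_num : (0:ℝ) ≤ 2)
  refine ((h1.add h2).add h3').congr fun p => ?_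
  rw [sahiE_three_interCoord_three U e hUe p]; ring

/-- **CONJUNCTIVE CLOSURE AT ORDER 3, any sub-collection.** [this work] -/
theorem combPos_sahiE_three_interCoord (P : Fin 3 → Prop) [DecidablePred P] :
    CombPos (fun _ : ι => 3) (fun p => sahiE (bernoulliWeight p) 3
      (fun j => ind (if P j then U j ∩ {ω : Set ι | e ∈ ω} else U j))) := by
  have hU' : ∀ σ : Equiv.Perm (Fin 3), ∀ j, IsUpperSet ((U ∘ σ) j) := fun σ j => hU _
  have hUe' : ∀ σ : Equiv.Perm (Fin 3), ∀ (j : Fin 3) (b : Bool), secAt e b ((U ∘ σ) j) = (U ∘ σ) j := fun σ j b => hUe _ b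
  have h3' : ∀ σ : Equiv.Perm (Fin 3),
      CombPos (fun _ : ι => 3) (fun p => sahiE (bernoulliWeight p) 3 (fun j => ind ((U ∘ σ) j))) := fun σ =>
    combPos_three_perm (f := fun j => ind (U j)) σ h3
  by_cases h0 : P 0 <;> by_cases h1 : P 1 <;> by_cases h2 : P 2
  · exact (combPos_sahiE_three_interCoord_three U hU e hUe h3).congr fun p =>
      congrArg (sahiE (bernoulliWeight p) 3) (funext fun j => by fin_cases j <;> simp [h0, h1, h2])
  · exact (combPos_sahiE_three_interCoord_two U hU e hUe h3).congr fun p =>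
      congrArg (sahiE (bernoulliWeight p) 3) (funext fun j => by fin_cases j <;> simp [h0, h1, h2])
  · exact (combPos_three_perm (Equiv.swap 1 2)
        (combPos_sahiE_three_interCoord_two (U ∘ Equiv.swap 1 2) (hU' _) e (hUe' _) (h3' _))).congr fun p =>
      congrArg (sahiE (bernoulliWeight p) 3) (funext fun j => by
        fin_cases j <;> simp [h0, h1, h2, Equiv.swap_apply_of_ne_of_ne])
  · exact (combPos_sahiE_three_interCoord_one U e hUe h3).congr fun p =>
      congrArg (sahiE (bernoulliWeight p) 3) (funext fun j => by fin_cases j <;> simp [h0, h1, h2])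
  · exact (combPos_three_perm (Equiv.swap 0 2)
        (combPos_sahiE_three_interCoord_two (U ∘ Equiv.swap 0 2) (hU' _) e (hUe' _) (h3' _))).congr fun p =>
      congrArg (sahiE (bernoulliWeight p) 3) (funext fun j => by
        fin_cases j <;> simp [h0, h1, h2, Equiv.swap_apply_of_ne_of_ne])
  · exact (combPos_three_perm (Equiv.swap 0 1)
        (combPos_sahiE_three_interCoord_one (U ∘ Equiv.swap 0 1) e (hUe' _) (h3' _))).congr fun p =>
      congrArg (sahiE (bernoulliWeight p) 3) (funext fun j => by
        fin_cases j <;> simp [h0, h1, h2, Equiv.swap_apply_of_ne_of_ne])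
  · exact (combPos_three_perm (Equiv.swap 0 2)
        (combPos_sahiE_three_interCoord_one (U ∘ Equiv.swap 0 2) e (hUe' _) (h3' _))).congr fun p =>
      congrArg (sahiE (bernoulliWeight p) 3) (funext fun j => by
        fin_cases j <;> simp [h0, h1, h2, Equiv.swap_apply_of_ne_of_ne])
  · exact h3.congr fun p =>
      congrArg (sahiE (bernoulliWeight p) 3) (funext fun j => by fin_cases j <;> simp [h0, h1, h2])

end Comb

/-! ### Conjunctive padding by an independent AND-system -/

section AndSystem

omit [Fintype ι] in
/-- Cylinders over coordinates not containing `e` ignore `e`. [folklore] -/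
theorem secAt_cylinder_of_notMem (e : ι) (R : Finset ι) (he : e ∉ R) (b : Bool) :
    secAt e b {ω : Set ι | ↑R ⊆ ω} = {ω : Set ι | ↑R ⊆ ω} := by
  ext ω
  simp only [mem_secAt, Set.mem_setOf_eq]
  constructor
  · intro h i hi
    have hie : i ≠ e := fun h' => he (h' ▸ Finset.mem_coe.1 hi)
    have := h hi
    cases b
    · simp only [forceAt, cond_false, Set.mem_sdiff, Set.mem_singleton_iff] at this; exact this.1
    · simp only [forceAt, cond_true, Set.mem_insert_iff] at this; exact this.resolve_left hie
  · intro h i hi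
    have hie : i ≠ e := fun h' => he (h' ▸ Finset.mem_coe.1 hi)
    cases b
    · simp only [forceAt, cond_false, Set.mem_sdiff, Set.mem_singleton_iff]; exact ⟨h hi, hie⟩
    · simp only [forceAt, cond_true, Set.mem_insert_iff]; exact Or.inr (h hi)

omit [Fintype ι] in
/-- Cylinders are increasing. [folklore] -/
theorem isUpperSet_cylinder (R : Finset ι) : IsUpperSet {ω : Set ι | ↑R ⊆ ω} :=
  fun _ _ hle h => Set.Subset.trans h hle

/-- **CONJUNCTIVE PADDING BY AN INDEPENDENT AND-SYSTEM (order 3).**  Let `U_0,U_1,U_2` be increasing events with `E_3(1_U)` comb-positive at multidegree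
`3`, and `S_0,S_1,S_2` sets of coordinates every one of which is ignored by every `U_j`.  Then `(U_k ∩ {ω | S_k ⊆ ω})_k` has `E_3` comb-positive at
multidegree `3`. [this work] -/
theorem combPos_sahiE_three_inter_and (U : Fin 3 → Set (Set ι)) (hU : ∀ j, IsUpperSet (U j)) (S : Fin 3 → Finset ι)
    (hUS : ∀ (j k : Fin 3), ∀ e ∈ S k, ∀ b : Bool, secAt e b (U j) = U j)
    (h3 : CombPos (fun _ : ι => 3) (fun p => sahiE (bernoulliWeight p) 3 (fun j => ind (U j)))) :
    CombPos (fun _ : ι => 3) (fun p => sahiE (bernoulliWeight p) 3 (fun k => ind (U k ∩ {ω : Set ι | ↑(S k) ⊆ ω}))) := by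
  classical
  suffices key : ∀ T : Finset ι, CombPos (fun _ : ι => 3)
      (fun p => sahiE (bernoulliWeight p) 3 (fun k => ind (U k ∩ {ω : Set ι | ↑(S k ∩ T) ⊆ ω}))) by
    refine (key Finset.univ).congr fun p => ?_
    congr 1; funext k
    simp only [Finset.inter_univ]
  intro T
  induction T using Finset.induction_on with
  | empty =>
    refine h3.congr fun p => ?_
    congr 1; funext k; congr 1
    ext ω; simp
  | insert e T heT ih =>
    by_cases hk : ∃ k, e ∈ S k
    · obtain ⟨k₀, hk₀⟩ := hk
      set W : Fin 3 → Set (Set ι) := fun k => U k ∩ {ω : Set ι | ↑(S k ∩ T) ⊆ ω} with hW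
      have hWup : ∀ k, IsUpperSet (W k) := fun k => (hU k).inter (isUpperSet_cylinder _)
      have hWe : ∀ (k : Fin 3) (b : Bool), secAt e b (W k) = W k := fun k b => by
        rw [hW]; dsimp only
        rw [secAt_inter, hUS k k₀ e hk₀ b,
          secAt_cylinder_of_notMem e (S k ∩ T) (fun h => heT (Finset.mem_inter.1 h).2) b]
      have h := combPos_sahiE_three_interCoord W hWup e hWe ih (fun k => e ∈ S k)
      refine h.congr fun p => ?_
      congr 1; funext k; congr 1
      ext ω
      by_cases hke : e ∈ S k
      · simp only [hke, if_true, hW, Set.mem_inter_iff, Set.mem_setOf_eq, Finset.coe_inter, Finset.coe_insert,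
          Set.subset_def, Set.mem_insert_iff, Finset.mem_coe]
        constructor
        · rintro ⟨hω, hsub⟩
          exact ⟨⟨hω, fun i ⟨hiS, hiT⟩ => hsub i ⟨hiS, Or.inr hiT⟩⟩, hsub e ⟨hke, Or.inl rfl⟩⟩
        · rintro ⟨⟨hω, hsub⟩, heω⟩
          refine ⟨hω, fun i ⟨hiS, hi⟩ => ?_⟩
          rcases hi with rfl | hiT
          · exact heω
          · exact hsub i ⟨hiS, hiT⟩
      · simp only [hke, if_false, hW, Set.mem_inter_iff, Set.mem_setOf_eq, Finset.coe_inter, Finset.coe_insert,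
          Set.subset_def, Set.mem_insert_iff, Finset.mem_coe]
        constructor
        · rintro ⟨hω, hsub⟩
          exact ⟨hω, fun i ⟨hiS, hiT⟩ => hsub i ⟨hiS, Or.inr hiT⟩⟩
        · rintro ⟨hω, hsub⟩
          refine ⟨hω, fun i ⟨hiS, hi⟩ => ?_⟩
          rcases hi with rfl | hiT
          · exact absurd hiS hke
          · exact hsub i ⟨hiS, hiT⟩
    · have hk' : ∀ k, e ∉ S k := fun k h => hk ⟨k, h⟩
      refine ih.congr fun p => ?_
      congr 1; funext k
      rw [Finset.inter_insert_of_notMem (hk' k)]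

/-- Law-level shadow of `combPos_sahiE_three_inter_and`. [this work] -/
theorem sahiE_three_nonneg_inter_and (q : ι → unitInterval) (U : Fin 3 → Set (Set ι)) (hU : ∀ j, IsUpperSet (U j))
    (S : Fin 3 → Finset ι) (hUS : ∀ (j k : Fin 3), ∀ e ∈ S k, ∀ b : Bool, secAt e b (U j) = U j)
    (h3 : CombPos (fun _ : ι => 3) (fun p => sahiE (bernoulliWeight p) 3 (fun j => ind (U j)))) :
    0 ≤ sahiE (bernoulliWeight q) 3 (fun k => ind (U k ∩ {ω : Set ι | ↑(S k) ⊆ ω})) :=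
  (combPos_sahiE_three_inter_and U hU S hUS h3).nonneg q

end AndSystem

end SahiCombConjunct

end Summit.CriticalPhenomena.PercolationContinuityZ3.Theorems

end
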